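import Summits.HodgeConjecture.CorCM.GaloisCyclicSemidirectTwoPowerNondegenerate
import Summits.HodgeConjecture.CorCM.CyclotomicTwoPowerPResidueObstruction
import HarnessLib

/-!
# Galois CM fields with group `C_p ⋊ C_{2^{a+2}}`: every primitive CM type is nondegenerate whenever
# `2^{a+1} ∣ p^f − 1` and `2^{a+2} ∤ p^f − 1` — i.e. whenever `2^{a+2} ∤ p − 1` and `2^{a+1} ∤ p + 1`

COR-CM (cell `pub-hodgecm2`), binder seat b04 (gen 26), count-neutral claim CYCLIC-SEMIDIRECT-RESIDUE, parts II♯ + IV♯ — the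
residue-field upgrade of `CorCM/GaloisCyclicSemidirectTwoPowerNondegenerate` (claim CYCLIC-SEMIDIRECT-TWO-POWER, the case
`f = 1`: `v₂(p − 1) = a + 1`).  KERNEL ONLY: theorems; no definition, no named fact, no `sorry`.  `HC_CM` is neither used nor
claimed: this is the Hodge conjecture for a NAMED CLASS of CM abelian varieties, proved outright.

SETTING.  `K` a Galois CM field with `Gal(K/ℚ) ≅ C_p ⋊ C_{2^{a+2}} = ⟨u, y | u^p = y^{2^{a+2}} = 1, y u y⁻¹ = u⁻¹⟩`
(Mathlib model `Multiplicative (ZMod p) ⋊[φ] Multiplicative (ZMod (2^(a+2)))`, `φ(1)` = inversion), `p` an odd prime,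
`[K:ℚ] = 2^{a+2} p`, complex conjugation `= y^{2^{a+1}}` (the unique involution).

THEOREM (`isNondegenerate_of_isPrimitive_of_pow_sub_one`).  If for some `f` one has `2^{a+1} ∣ p^f − 1` and
`2^{a+2} ∤ p^f − 1` — equivalently (lifting the exponent, `CorCM/CyclotomicTwoPowerPResidueField`) `2^{a+2} ∤ p − 1` AND
`2^{a+1} ∤ p + 1` — then EVERY PRIMITIVE CM type of `K` is NONDEGENERATE (rank `2^{a+1}p + 1`); hence every SIMPLE abelian
variety (dimension `2^{a+1}p`) with complex multiplication by `K` satisfies the HODGE CONJECTURE together with ALL ITS POWERS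
(`hodgeConjectureFor_pow_of_isSimple_of_pow_sub_one`, `…_of_not_dvd`).  The mechanism is that of the `f = 1` file: by the
two-sheet model theorem (`CorCM/GaloisCyclicSemidirectTwoPowerTwoSheet`) a degenerate primitive type would make a primitive
`2^{a+1}`-th root of unity a quotient of norms `z ρ(z)` from `ℚ(ζ_{2^{a+1}p})` to the fixed field of the automorphism `ρ`
fixing `μ_{2^{a+1}}` and inverting `μ_p`; the local obstruction at `p` now lives in the residue field `𝔽_{p^f}` instead of
`𝔽_p` (`CorCM/CyclotomicTwoPowerPResidue{Descent,Obstruction}`).  In words: **`C_p ⋊ C_{2^{a+2}}` is GOOD unless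
`2^{a+2} ∣ p − 1` or `2^{a+1} ∣ p + 1`** — for `a = 1` (`C_p ⋊ C₈`): GOOD for `p ≡ 5 (mod 8)`; for `a = 2` (`C_p ⋊ C₁₆`):
GOOD for `p ≡ 3, 5 (mod 8)` and `p ≡ 9 (mod 16)`; for `a = 3` (`C_p ⋊ C₃₂`): GOOD for `p ≡ 3, 5, 7, 9, 11, 13 (mod 16)` and
`p ≡ 17 (mod 32)`.  The seat census (two-sheet, exhaustive or by compute job) agrees on both sides of the boundary:
`C₃ ⋊ C₁₆`, `C₅ ⋊ C₁₆`, `C₃ ⋊ C₃₂`, `C₅ ⋊ C₈`, `C₁₃ ⋊ C₈` GOOD (theorems below), `C₃ ⋊ C₈`, `C₇ ⋊ C₈`, `C₁₁ ⋊ C₈`, `C₇ ⋊ C₁₆` BAD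
(primitive degenerate types found; no theorem claimed here).

* §1 **`isNondegenerate_of_isPrimitive_of_pow_sub_one`**, `cmTypeRank_eq_of_isPrimitive_of_pow_sub_one`,
  **`hodgeConjectureFor_pow_of_isSimple_of_pow_sub_one`**, `hodgeConjectureFor_of_isSimple_of_pow_sub_one`,
  `hodgeClassSpan_pow_eq_divisorClassesSpan_of_isSimple_of_pow_sub_one`.
* §2 (closed form, via `CyclotomicTwoPowerP.Residue.exists_pow_sub_one_of_not_dvd` — LTE)
  **`isNondegenerate_of_isPrimitive_of_not_dvd`**, **`hodgeConjectureFor_pow_of_isSimple_of_not_dvd`**.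
* §3 instances: `C₃ ⋊ C₁₆` (order `48`), `C₅ ⋊ C₁₆` (`80`), `C₃ ⋊ C₃₂` (`96`), `C₁₃ ⋊ C₁₆` (`208`), `C₇ ⋊ C₃₂` (`224`).

## References

* [Kubota1965] T. Kubota, Trans. AMS 118 (1965), §2, §4 Lemma 2.
* [Dodson1984] B. Dodson, *The structure of Galois groups of CM-fields*, Trans. AMS 283 (1984), §3.1, §5.3.
* [Shimura1998] G. Shimura, *Abelian Varieties with Complex Multiplication and Modular Functions*, §8.2 Prop. 26.
* [Gordon1999HodgeAVSurvey] B. B. Gordon, *A survey of the Hodge conjecture for abelian varieties*, Thm. 6.4, §9.4.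
* [FeinGordonSmith1971] B. Fein, B. Gordon, J. H. Smith, J. Number Theory 3 (1971), 310–315.
-/

noncomputable section

open CategoryTheory CategoryTheory.Limits NumberField
open scoped BigOperators

namespace Summit.HodgeConjecture.CorCM.GaloisCyclicSemidirectTwoPower

open Literature.NumberTheory.ComplexMultiplication
open Literature.AlgebraicGeometry.Motives (AbelianVariety CMType)
open Literature.AlgebraicGeometry.HodgeTheory
open Literature.AlgebraicGeometry.ComplexMultiplication (IsCMTypeRealisation isSimple_iff_isPrimitive)
open Literature.AlgebraicGeometry.Pohlmann1968
open Summit.HodgeConjecture.CorCM.GaloisRank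
open Summit.HodgeConjecture.CorCM.CyclotomicTwoPowerP.Residue (exists_subfield_rho_of_pow_sub_one exists_pow_sub_one_of_not_dvd)

/-! ## §1 Nondegeneracy and the Hodge conjecture for `2^{a+1} ∣ p^f − 1`, `2^{a+2} ∤ p^f − 1` -/

section Residue

variable {p a : ℕ} [Fact p.Prime]
variable {K : Type} [Field K] [NumberField K] [IsCMField K] [IsGalois ℚ K]
variable {Φ : CMType K} {A : AbelianVariety ℂ} {ι : 𝓞 K →+* End A}
  {θ : K →+* Module.End ℂ (complexBetti A.X 1)}

/-- **THEOREM.  `Gal(K/ℚ) ≅ C_p ⋊ C_{2^{a+2}}` (`p` odd, `φ(1)` = inversion), `2^{a+1} ∣ p^f − 1`, `2^{a+2} ∤ p^f − 1`: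
every PRIMITIVE CM type of `K` is NONDEGENERATE** — unconditionally. [cite: Kubota1965, §4 Lemma 2]
[cite: Shimura1998, §8.2 Prop. 26] [cite: FeinGordonSmith1971, pp. 310–315] -/
theorem isNondegenerate_of_isPrimitive_of_pow_sub_one (hp2 : p ≠ 2) {f : ℕ} (hf1 : 2 ^ (a + 1) ∣ p ^ f - 1)
    (hf2 : ¬ 2 ^ (a + 2) ∣ p ^ f - 1)
    (φ : Multiplicative (ZMod (2 ^ (a + 2))) →* MulAut (Multiplicative (ZMod p)))
    (hφ : ∀ v : Multiplicative (ZMod p), φ (Multiplicative.ofAdd 1) v = v⁻¹)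
    (e : (K ≃ₐ[ℚ] K) ≃* Multiplicative (ZMod p) ⋊[φ] Multiplicative (ZMod (2 ^ (a + 2)))) {Φ : CMType K}
    (φ₀ : K →+* ℂ) (hprim : IsPrimitive (ℂ ≃+* ℂ) Φ.1 φ₀) : IsNondegenerate Φ := by
  obtain ⟨M, ρ, hM, hρ2, hρp, hN⟩ := exists_subfield_rho_of_pow_sub_one (a := a) (Fact.out : p.Prime) hp2 hf1 hf2
  exact isNondegenerate_of_isPrimitive_cyclicSemidirect hp2 φ hφ M ρ hM hρ2 hρp hN e φ₀ hprim

/-- The rank: `cmTypeRank Φ = 2^{a+1} p + 1`. [cite: Kubota1965, §2 (p. 115)] -/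
theorem cmTypeRank_eq_of_isPrimitive_of_pow_sub_one (hp2 : p ≠ 2) {f : ℕ} (hf1 : 2 ^ (a + 1) ∣ p ^ f - 1)
    (hf2 : ¬ 2 ^ (a + 2) ∣ p ^ f - 1)
    (φ : Multiplicative (ZMod (2 ^ (a + 2))) →* MulAut (Multiplicative (ZMod p)))
    (hφ : ∀ v : Multiplicative (ZMod p), φ (Multiplicative.ofAdd 1) v = v⁻¹)
    (e : (K ≃ₐ[ℚ] K) ≃* Multiplicative (ZMod p) ⋊[φ] Multiplicative (ZMod (2 ^ (a + 2)))) {Φ : CMType K}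
    (φ₀ : K →+* ℂ) (hprim : IsPrimitive (ℂ ≃+* ℂ) Φ.1 φ₀) : cmTypeRank Φ = 2 ^ (a + 1) * p + 1 := by
  have h := isNondegenerate_of_isPrimitive_of_pow_sub_one hp2 hf1 hf2 φ hφ e φ₀ hprim
  rw [isNondegenerate_iff, finrank_eq φ e] at h
  rw [h, pow_succ 2 (a + 1)]
  have : 0 < 2 ^ (a + 1) * p := by have := (Fact.out : p.Prime).pos; positivity
  rw [show 2 ^ (a + 1) * 2 * p = 2 ^ (a + 1) * p * 2 by ring]
  omega

/-- **THE HODGE CONJECTURE FOR EVERY POWER OF EVERY SIMPLE ABELIAN VARIETY WITH COMPLEX MULTIPLICATION BY A GALOIS CM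
FIELD WITH GROUP `C_p ⋊ C_{2^{a+2}}`, `2^{a+1} ∣ p^f − 1`, `2^{a+2} ∤ p^f − 1`** (dimension `2^{a+1} p`) — unconditionally.
[cite: Gordon1999HodgeAVSurvey, Thm. 6.4] [cite: Shimura1998, §8.2 Prop. 26] -/
theorem hodgeConjectureFor_pow_of_isSimple_of_pow_sub_one (hp2 : p ≠ 2) {f : ℕ} (hf1 : 2 ^ (a + 1) ∣ p ^ f - 1)
    (hf2 : ¬ 2 ^ (a + 2) ∣ p ^ f - 1)
    (φ : Multiplicative (ZMod (2 ^ (a + 2))) →* MulAut (Multiplicative (ZMod p)))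
    (hφ : ∀ v : Multiplicative (ZMod p), φ (Multiplicative.ofAdd 1) v = v⁻¹)
    (e : (K ≃ₐ[ℚ] K) ≃* Multiplicative (ZMod p) ⋊[φ] Multiplicative (ZMod (2 ^ (a + 2))))
    (hA : IsCMTypeRealisation Φ A ι θ) (hs : A.IsSimple) (N : ℕ) :
    HodgeConjectureFor (⨁ fun _ : Fin N => A).dim (⨁ fun _ : Fin N => A).X := by
  obtain ⟨φ₀⟩ := (inferInstance : Nonempty (K →+* ℂ))
  exact (isNondegenerate_of_isPrimitive_of_pow_sub_one hp2 hf1 hf2 φ hφ e φ₀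
    ((isSimple_iff_isPrimitive hA φ₀).1 hs)).hodgeConjectureFor_pow hA N

/-- The Hodge conjecture for the simple abelian variety itself. [cite: Gordon1999HodgeAVSurvey, Thm. 6.4] -/
theorem hodgeConjectureFor_of_isSimple_of_pow_sub_one (hp2 : p ≠ 2) {f : ℕ} (hf1 : 2 ^ (a + 1) ∣ p ^ f - 1)
    (hf2 : ¬ 2 ^ (a + 2) ∣ p ^ f - 1)
    (φ : Multiplicative (ZMod (2 ^ (a + 2))) →* MulAut (Multiplicative (ZMod p)))
    (hφ : ∀ v : Multiplicative (ZMod p), φ (Multiplicative.ofAdd 1) v = v⁻¹)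
    (e : (K ≃ₐ[ℚ] K) ≃* Multiplicative (ZMod p) ⋊[φ] Multiplicative (ZMod (2 ^ (a + 2))))
    (hA : IsCMTypeRealisation Φ A ι θ) (hs : A.IsSimple) : HodgeConjectureFor A.dim A.X := by
  obtain ⟨φ₀⟩ := (inferInstance : Nonempty (K →+* ℂ))
  exact (isNondegenerate_of_isPrimitive_of_pow_sub_one hp2 hf1 hf2 φ hφ e φ₀
    ((isSimple_iff_isPrimitive hA φ₀).1 hs)).hodgeConjectureFor hA

/-- `Bᵐ(Aⁿ) ⊗ ℂ = Dᵐ(Aⁿ) ⊗ ℂ` on every power (White–Hazama). [cite: Gordon1999HodgeAVSurvey, §9.3] -/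
theorem hodgeClassSpan_pow_eq_divisorClassesSpan_of_isSimple_of_pow_sub_one (hp2 : p ≠ 2) {f : ℕ}
    (hf1 : 2 ^ (a + 1) ∣ p ^ f - 1) (hf2 : ¬ 2 ^ (a + 2) ∣ p ^ f - 1)
    (φ : Multiplicative (ZMod (2 ^ (a + 2))) →* MulAut (Multiplicative (ZMod p)))
    (hφ : ∀ v : Multiplicative (ZMod p), φ (Multiplicative.ofAdd 1) v = v⁻¹)
    (e : (K ≃ₐ[ℚ] K) ≃* Multiplicative (ZMod p) ⋊[φ] Multiplicative (ZMod (2 ^ (a + 2))))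
    (hA : IsCMTypeRealisation Φ A ι θ) (hs : A.IsSimple) (N m : ℕ) :
    Literature.AlgebraicGeometry.VanGeemen1994.hodgeClassSpan (⨁ fun _ : Fin N => A).dim (⨁ fun _ : Fin N => A).X m =
      Literature.Barriers.HodgeConjecture.divisorClassesSpan (⨁ fun _ : Fin N => A).X
        (⨁ fun _ : Fin N => A).dim m := by
  obtain ⟨φ₀⟩ := (inferInstance : Nonempty (K →+* ℂ))
  exact (isNondegenerate_of_isPrimitive_of_pow_sub_one hp2 hf1 hf2 φ hφ e φ₀
    ((isSimple_iff_isPrimitive hA φ₀).1 hs)).hodgeClassSpan_pow_eq_divisorClassesSpan hA N m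

end Residue

/-! ## §2 The closed form: `2^{a+2} ∤ p − 1` and `2^{a+1} ∤ p + 1` -/

section ClosedForm

variable {p a : ℕ} [Fact p.Prime]
variable {K : Type} [Field K] [NumberField K] [IsCMField K] [IsGalois ℚ K]
variable {Φ : CMType K} {A : AbelianVariety ℂ} {ι : 𝓞 K →+* End A}
  {θ : K →+* Module.End ℂ (complexBetti A.X 1)}

/-- **THEOREM (closed form).  `Gal(K/ℚ) ≅ C_p ⋊ C_{2^{a+2}}` (`p` odd, `φ(1)` = inversion) with `2^{a+2} ∤ p − 1` and
`2^{a+1} ∤ p + 1`: every PRIMITIVE CM type of `K` is NONDEGENERATE.** [cite: Kubota1965, §4 Lemma 2]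
[cite: Shimura1998, §8.2 Prop. 26] [cite: FeinGordonSmith1971, pp. 310–315] -/
theorem isNondegenerate_of_isPrimitive_of_not_dvd (hp2 : p ≠ 2) (h1 : ¬ 2 ^ (a + 2) ∣ p - 1)
    (h2 : ¬ 2 ^ (a + 1) ∣ p + 1)
    (φ : Multiplicative (ZMod (2 ^ (a + 2))) →* MulAut (Multiplicative (ZMod p)))
    (hφ : ∀ v : Multiplicative (ZMod p), φ (Multiplicative.ofAdd 1) v = v⁻¹)
    (e : (K ≃ₐ[ℚ] K) ≃* Multiplicative (ZMod p) ⋊[φ] Multiplicative (ZMod (2 ^ (a + 2)))) {Φ : CMType K}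
    (φ₀ : K →+* ℂ) (hprim : IsPrimitive (ℂ ≃+* ℂ) Φ.1 φ₀) : IsNondegenerate Φ := by
  obtain ⟨f, hf1, hf2⟩ := exists_pow_sub_one_of_not_dvd (a := a) (Fact.out : p.Prime) hp2 h1 h2
  exact isNondegenerate_of_isPrimitive_of_pow_sub_one hp2 hf1 hf2 φ hφ e φ₀ hprim

/-- **THE HODGE CONJECTURE FOR EVERY POWER OF EVERY SIMPLE ABELIAN VARIETY WITH COMPLEX MULTIPLICATION BY A GALOIS CM
FIELD WITH GROUP `C_p ⋊ C_{2^{a+2}}`, `2^{a+2} ∤ p − 1`, `2^{a+1} ∤ p + 1`** (dimension `2^{a+1} p`) — unconditionally.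
[cite: Gordon1999HodgeAVSurvey, Thm. 6.4] [cite: Shimura1998, §8.2 Prop. 26] -/
theorem hodgeConjectureFor_pow_of_isSimple_of_not_dvd (hp2 : p ≠ 2) (h1 : ¬ 2 ^ (a + 2) ∣ p - 1)
    (h2 : ¬ 2 ^ (a + 1) ∣ p + 1)
    (φ : Multiplicative (ZMod (2 ^ (a + 2))) →* MulAut (Multiplicative (ZMod p)))
    (hφ : ∀ v : Multiplicative (ZMod p), φ (Multiplicative.ofAdd 1) v = v⁻¹)
    (e : (K ≃ₐ[ℚ] K) ≃* Multiplicative (ZMod p) ⋊[φ] Multiplicative (ZMod (2 ^ (a + 2))))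
    (hA : IsCMTypeRealisation Φ A ι θ) (hs : A.IsSimple) (N : ℕ) :
    HodgeConjectureFor (⨁ fun _ : Fin N => A).dim (⨁ fun _ : Fin N => A).X := by
  obtain ⟨f, hf1, hf2⟩ := exists_pow_sub_one_of_not_dvd (a := a) (Fact.out : p.Prime) hp2 h1 h2
  exact hodgeConjectureFor_pow_of_isSimple_of_pow_sub_one hp2 hf1 hf2 φ hφ e hA hs N

/-- The Hodge conjecture for the simple abelian variety itself (closed form). [cite: Gordon1999HodgeAVSurvey, Thm. 6.4] -/
theorem hodgeConjectureFor_of_isSimple_of_not_dvd (hp2 : p ≠ 2) (h1 : ¬ 2 ^ (a + 2) ∣ p - 1)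
    (h2 : ¬ 2 ^ (a + 1) ∣ p + 1)
    (φ : Multiplicative (ZMod (2 ^ (a + 2))) →* MulAut (Multiplicative (ZMod p)))
    (hφ : ∀ v : Multiplicative (ZMod p), φ (Multiplicative.ofAdd 1) v = v⁻¹)
    (e : (K ≃ₐ[ℚ] K) ≃* Multiplicative (ZMod p) ⋊[φ] Multiplicative (ZMod (2 ^ (a + 2))))
    (hA : IsCMTypeRealisation Φ A ι θ) (hs : A.IsSimple) : HodgeConjectureFor A.dim A.X := by
  obtain ⟨f, hf1, hf2⟩ := exists_pow_sub_one_of_not_dvd (a := a) (Fact.out : p.Prime) hp2 h1 h2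
  exact hodgeConjectureFor_of_isSimple_of_pow_sub_one hp2 hf1 hf2 φ hφ e hA hs

end ClosedForm

/-! ## §3 Instances: `C₃ ⋊ C₁₆`, `C₅ ⋊ C₁₆`, `C₃ ⋊ C₃₂`, `C₁₃ ⋊ C₁₆`, `C₇ ⋊ C₃₂` -/

section Instances

variable {K : Type} [Field K] [NumberField K] [IsCMField K] [IsGalois ℚ K]
variable {Φ : CMType K} {A : AbelianVariety ℂ} {ι : 𝓞 K →+* End A}
  {θ : K →+* Module.End ℂ (complexBetti A.X 1)}

/-- **`C₃ ⋊ C₁₆` (order `48`, `a = 2`, `f = 2`: `8 ∣ 3² − 1 = 8`, `16 ∤ 8`) is GOOD**: every primitive CM type is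
nondegenerate of rank `25`, and the Hodge conjecture holds for every power of every simple CM abelian `24`-fold with complex
multiplication by a Galois CM field with this group — a group of order `48` outside all earlier GOOD families.
[cite: Gordon1999HodgeAVSurvey, Thm. 6.4] -/
theorem hodgeConjectureFor_pow_of_isSimple_cyclic3_semidirect_16
    (φ : Multiplicative (ZMod (2 ^ (2 + 2))) →* MulAut (Multiplicative (ZMod 3)))
    (hφ : ∀ v : Multiplicative (ZMod 3), φ (Multiplicative.ofAdd 1) v = v⁻¹)
    (e : (K ≃ₐ[ℚ] K) ≃* Multiplicative (ZMod 3) ⋊[φ] Multiplicative (ZMod (2 ^ (2 + 2))))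
    (hA : IsCMTypeRealisation Φ A ι θ) (hs : A.IsSimple) (N : ℕ) :
    HodgeConjectureFor (⨁ fun _ : Fin N => A).dim (⨁ fun _ : Fin N => A).X :=
  haveI : Fact (Nat.Prime 3) := ⟨Nat.prime_three⟩
  hodgeConjectureFor_pow_of_isSimple_of_pow_sub_one (a := 2) (f := 2) (by norm_num) (by norm_num) (by norm_num)
    φ hφ e hA hs N

/-- `C₃ ⋊ C₁₆`: the rank of a primitive CM type is `25`. [cite: Kubota1965, §2 (p. 115)] -/
theorem isNondegenerate_of_isPrimitive_cyclic3_semidirect_16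
    (φ : Multiplicative (ZMod (2 ^ (2 + 2))) →* MulAut (Multiplicative (ZMod 3)))
    (hφ : ∀ v : Multiplicative (ZMod 3), φ (Multiplicative.ofAdd 1) v = v⁻¹)
    (e : (K ≃ₐ[ℚ] K) ≃* Multiplicative (ZMod 3) ⋊[φ] Multiplicative (ZMod (2 ^ (2 + 2)))) (Φ : CMType K)
    (φ₀ : K →+* ℂ) (hprim : IsPrimitive (ℂ ≃+* ℂ) Φ.1 φ₀) : IsNondegenerate Φ ∧ cmTypeRank Φ = 25 :=
  haveI : Fact (Nat.Prime 3) := ⟨Nat.prime_three⟩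
  ⟨isNondegenerate_of_isPrimitive_of_pow_sub_one (a := 2) (f := 2) (by norm_num) (by norm_num) (by norm_num) φ hφ e φ₀
    hprim, by
    have h := cmTypeRank_eq_of_isPrimitive_of_pow_sub_one (a := 2) (f := 2) (by norm_num) (by norm_num) (by norm_num)
      φ hφ e φ₀ hprim
    rw [h]; norm_num⟩

/-- **`C₅ ⋊ C₁₆` (order `80`, `a = 2`, `f = 2`: `8 ∣ 24`, `16 ∤ 24`) is GOOD**: the Hodge conjecture for every power of every
simple CM abelian `40`-fold with complex multiplication by a Galois CM field with this group.
[cite: Gordon1999HodgeAVSurvey, Thm. 6.4] -/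
theorem hodgeConjectureFor_pow_of_isSimple_cyclic5_semidirect_16
    (φ : Multiplicative (ZMod (2 ^ (2 + 2))) →* MulAut (Multiplicative (ZMod 5)))
    (hφ : ∀ v : Multiplicative (ZMod 5), φ (Multiplicative.ofAdd 1) v = v⁻¹)
    (e : (K ≃ₐ[ℚ] K) ≃* Multiplicative (ZMod 5) ⋊[φ] Multiplicative (ZMod (2 ^ (2 + 2))))
    (hA : IsCMTypeRealisation Φ A ι θ) (hs : A.IsSimple) (N : ℕ) :
    HodgeConjectureFor (⨁ fun _ : Fin N => A).dim (⨁ fun _ : Fin N => A).X :=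
  haveI : Fact (Nat.Prime 5) := ⟨Nat.prime_five⟩
  hodgeConjectureFor_pow_of_isSimple_of_pow_sub_one (a := 2) (f := 2) (by norm_num) (by norm_num) (by norm_num)
    φ hφ e hA hs N

/-- **`C₃ ⋊ C₃₂` (order `96`, `a = 3`, `f = 4`: `16 ∣ 3⁴ − 1 = 80`, `32 ∤ 80`) is GOOD**: the Hodge conjecture for every power
of every simple CM abelian `48`-fold with complex multiplication by a Galois CM field with this group.
[cite: Gordon1999HodgeAVSurvey, Thm. 6.4] -/
theorem hodgeConjectureFor_pow_of_isSimple_cyclic3_semidirect_32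
    (φ : Multiplicative (ZMod (2 ^ (3 + 2))) →* MulAut (Multiplicative (ZMod 3)))
    (hφ : ∀ v : Multiplicative (ZMod 3), φ (Multiplicative.ofAdd 1) v = v⁻¹)
    (e : (K ≃ₐ[ℚ] K) ≃* Multiplicative (ZMod 3) ⋊[φ] Multiplicative (ZMod (2 ^ (3 + 2))))
    (hA : IsCMTypeRealisation Φ A ι θ) (hs : A.IsSimple) (N : ℕ) :
    HodgeConjectureFor (⨁ fun _ : Fin N => A).dim (⨁ fun _ : Fin N => A).X :=
  haveI : Fact (Nat.Prime 3) := ⟨Nat.prime_three⟩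
  hodgeConjectureFor_pow_of_isSimple_of_pow_sub_one (a := 3) (f := 4) (by norm_num) (by norm_num) (by norm_num)
    φ hφ e hA hs N

/-- **`C₁₃ ⋊ C₁₆` (order `208`, `a = 2`, `f = 2`: `8 ∣ 168`, `16 ∤ 168`; `13 ≡ 13 (mod 16)` is outside the `f = 1` theorem)
is GOOD**: the Hodge conjecture for every power of every simple CM abelian `104`-fold with complex multiplication by a Galois
CM field with this group. [cite: Gordon1999HodgeAVSurvey, Thm. 6.4] -/
theorem hodgeConjectureFor_pow_of_isSimple_cyclic13_semidirect_16
    (φ : Multiplicative (ZMod (2 ^ (2 + 2))) →* MulAut (Multiplicative (ZMod 13)))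
    (hφ : ∀ v : Multiplicative (ZMod 13), φ (Multiplicative.ofAdd 1) v = v⁻¹)
    (e : (K ≃ₐ[ℚ] K) ≃* Multiplicative (ZMod 13) ⋊[φ] Multiplicative (ZMod (2 ^ (2 + 2))))
    (hA : IsCMTypeRealisation Φ A ι θ) (hs : A.IsSimple) (N : ℕ) :
    HodgeConjectureFor (⨁ fun _ : Fin N => A).dim (⨁ fun _ : Fin N => A).X :=
  haveI : Fact (Nat.Prime 13) := ⟨by norm_num⟩
  hodgeConjectureFor_pow_of_isSimple_of_pow_sub_one (a := 2) (f := 2) (by norm_num) (by norm_num) (by norm_num)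
    φ hφ e hA hs N

/-- **`C₇ ⋊ C₃₂` (order `224`, `a = 3`, `f = 2`: `16 ∣ 48`, `32 ∤ 48`) is GOOD**: the Hodge conjecture for every power of
every simple CM abelian `112`-fold with complex multiplication by a Galois CM field with this group (whereas `C₇ ⋊ C₈` and
`C₇ ⋊ C₁₆` carry primitive degenerate types by the seat census). [cite: Gordon1999HodgeAVSurvey, Thm. 6.4] -/
theorem hodgeConjectureFor_pow_of_isSimple_cyclic7_semidirect_32
    (φ : Multiplicative (ZMod (2 ^ (3 + 2))) →* MulAut (Multiplicative (ZMod 7)))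
    (hφ : ∀ v : Multiplicative (ZMod 7), φ (Multiplicative.ofAdd 1) v = v⁻¹)
    (e : (K ≃ₐ[ℚ] K) ≃* Multiplicative (ZMod 7) ⋊[φ] Multiplicative (ZMod (2 ^ (3 + 2))))
    (hA : IsCMTypeRealisation Φ A ι θ) (hs : A.IsSimple) (N : ℕ) :
    HodgeConjectureFor (⨁ fun _ : Fin N => A).dim (⨁ fun _ : Fin N => A).X :=
  haveI : Fact (Nat.Prime 7) := ⟨by norm_num⟩
  hodgeConjectureFor_pow_of_isSimple_of_pow_sub_one (a := 3) (f := 2) (by norm_num) (by norm_num) (by norm_num)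
    φ hφ e hA hs N

end Instances

end Summit.HodgeConjecture.CorCM.GaloisCyclicSemidirectTwoPower

end
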